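import Summits.ValiantsHypothesis.ValiantsHypothesis.Theorems.NewtonFramesTwoProductsFrameRungTwoBinomial

/-!
# Crux `TwoProducts` (stmt-5906), line `FrameRungTwo`: trinomial frames — words, letter transfer, no double match

First of four files proving the line's OPEN stub `stub_crossCancelCount` for `k ≤ 2`, `t ≤ 3` on pairs of dissociated frames
WITHOUT PARALLELOGRAM COINCIDENCES (`…FrameRungTwoTrinomial.lean`: `crossCancelCount_le_three_of_noParallelogram`, `C = 6`).
The binomial rigidity argument (`…BinomialRigidity.lean`) fails at `t = 3` exactly through in-coordinate carries; the
hypothesis "no word sum equals another word sum shifted by `x + y − 2c` for three distinct letters `c, x, y` of one coordinate"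
(equivalently: completing each letter triple to a parallelogram keeps the frame dissociated) is what rules them out.  This file:
word sums and coefficients relative to a key-top tuple (`emb_sum_eq`, `prod_coeff_ratio` — no sparsity needed), the
letter-level transfer of a demotion set through an injective matching (`transfer_letters`), and the key lemma
`no_double_match`: two one-letter demotions of one frame cannot be matched into two different letters of ONE coordinate of the
other frame while their joint two-letter demotion lies above the vertex (it would be cancelled, hence a word of the other
frame — a parallelogram coincidence).
Honest scope: a `t`-variant (trinomial frames without parallelogram coincidences, `k ≤ 2`) of ONE stub of a rung strictly
below the crux `TwoProducts`; nothing here bears on the crux in general or on `VP ≠ VNP`. [ours; setting KPTT arXiv:1308.2286 §2, §5]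
-/

set_option linter.dupNamespace false

namespace Summit.ValiantsHypothesis.ValiantsHypothesis.Theorems.NewtonFramesTwoProducts.FrameRungTwoTrinomial

open MvPolynomial
open scoped BigOperators Classical
open Summit.ValiantsHypothesis.Theorems.DissociatedFixedK (lexKey lexKey_injective lexTop lexTop_mem lexKey_le_lexTop
  stub_topTupleCount count_arith)
open Summit.ValiantsHypothesis.ValiantsHypothesis.Theorems.DissociatedFixedK.Negative (emb emb_injective)
open Summit.ValiantsHypothesis.ValiantsHypothesis.Theorems.NewtonFramesTwoProducts.FrameRungTwoBinomial
  (emb_add emb_sum lexKey_sum apply_le_of_lexKey_le lexKey_lt_of_apply_lt lexKey_sum_lt_sum lexKey_sum_le_sum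
   eq_T_of_not_mem_filter ne_T_of_mem_filter lexKey_sum_lt_T lexKey_sum_le_T coeff_word exists_word prod_coeff_ne_zero
   top_eq mem_cover card_cover_le cross_empty_of_union_subset support_filter_sum_subset_one)

noncomputable section

/-! ## Words relative to a top tuple (no sparsity needed) -/

section Words

variable {m : ℕ}

/-- Word sum = top sum minus the letter gaps. [folklore] -/
theorem emb_sum_eq (T a : Fin m → (Fin 2 →₀ ℕ)) :
    emb (∑ j, a j) = emb (∑ j, T j) - ∑ j, (emb (T j) - emb (a j)) := by
  rw [emb_sum, emb_sum, Finset.sum_sub_distrib, sub_sub_cancel]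

/-- The gaps of a word vanish off its demotion set. [folklore] -/
theorem sum_gap_eq_sum_filter (T a : Fin m → (Fin 2 →₀ ℕ)) :
    ∑ j, (emb (T j) - emb (a j)) = ∑ j ∈ Finset.univ.filter (fun i => a i ≠ T i), (emb (T j) - emb (a j)) := by
  rw [← Finset.sum_filter_add_sum_filter_not Finset.univ (fun i => a i ≠ T i)]
  conv_rhs => rw [← add_zero (∑ j ∈ Finset.univ.filter (fun i => a i ≠ T i), (emb (T j) - emb (a j)))]
  congr 1
  refine Finset.sum_eq_zero fun j hj => ?_
  rw [Finset.mem_filter] at hj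
  have : a j = T j := by by_contra h; exact hj.2 h
  rw [this, sub_self]

/-- Sum of the one-letter demotion `T[j ↦ x]`. [folklore] -/
theorem emb_sum_update (T : Fin m → (Fin 2 →₀ ℕ)) (j : Fin m) (x : Fin 2 →₀ ℕ) :
    emb (∑ i, Function.update T j x i) = emb (∑ i, T i) - (emb (T j) - emb x) := by
  rw [emb_sum_eq T (Function.update T j x)]
  congr 1
  rw [Finset.sum_eq_single j]
  · rw [Function.update_self]
  · intro i _ hi; rw [Function.update_of_ne hi, sub_self]
  · intro h; exact absurd (Finset.mem_univ j) h

/-- Sum of the two-letter demotion `T[j₁ ↦ x₁][j₂ ↦ x₂]` (`j₁ ≠ j₂`). [folklore] -/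
theorem emb_sum_update_update (T : Fin m → (Fin 2 →₀ ℕ)) {j₁ j₂ : Fin m} (h : j₁ ≠ j₂) (x₁ x₂ : Fin 2 →₀ ℕ) :
    emb (∑ i, Function.update (Function.update T j₁ x₁) j₂ x₂ i) =
      emb (∑ i, T i) - (emb (T j₁) - emb x₁) - (emb (T j₂) - emb x₂) := by
  rw [emb_sum_eq T]
  have hsplit : ∑ i, (emb (T i) - emb (Function.update (Function.update T j₁ x₁) j₂ x₂ i)) =
      (emb (T j₁) - emb x₁) + (emb (T j₂) - emb x₂) := by
    rw [← Finset.sum_erase_add _ _ (Finset.mem_univ j₂), Function.update_self,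
      ← Finset.sum_erase_add _ _ (Finset.mem_erase.2 ⟨h, Finset.mem_univ j₁⟩), Function.update_of_ne h,
      Function.update_self]
    rw [Finset.sum_eq_zero, zero_add]
    intro i hi
    rw [Finset.mem_erase, Finset.mem_erase] at hi
    rw [Function.update_of_ne hi.2.1, Function.update_of_ne hi.1, sub_self]
  rw [hsplit]; abel

/-- A word is key-below any word obtained from it by promoting some (at least one) demoted letters to the top. -/
theorem lexKey_sum_lt_promote (l : (Fin 2 → ℝ) →L[ℝ] ℝ) (f : Fin m → MvPolynomial (Fin 2) ℂ) (T : Fin m → (Fin 2 →₀ ℕ))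
    (hTmax : ∀ j, ∀ x ∈ (f j).support, lexKey l x ≤ lexKey l (T j))
    {a b : Fin m → (Fin 2 →₀ ℕ)} (ha : ∀ j, a j ∈ (f j).support) (hb : ∀ j, b j = a j ∨ b j = T j)
    (hstrict : ∃ j, b j = T j ∧ a j ≠ T j) : lexKey l (∑ j, a j) < lexKey l (∑ j, b j) := by
  apply lexKey_sum_lt_sum l
  · intro j
    rcases hb j with h | h
    · rw [h]
    · rw [h]; exact hTmax j _ (ha j)
  · obtain ⟨j, hj, hja⟩ := hstrict
    exact ⟨j, by rw [hj]; exact lt_of_le_of_ne (hTmax j _ (ha j)) (fun h => hja (lexKey_injective l h))⟩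

/-- One-letter demotions are determined by their sums (dissociation). -/
theorem update_sum_inj (f : Fin m → MvPolynomial (Fin 2) ℂ) (T : Fin m → (Fin 2 →₀ ℕ)) (hT : ∀ j, T j ∈ (f j).support)
    (hinjf : ∀ a b : Fin m → (Fin 2 →₀ ℕ), (∀ j, a j ∈ (f j).support) → (∀ j, b j ∈ (f j).support) →
      ∑ j, a j = ∑ j, b j → a = b)
    {j i : Fin m} {x y : Fin 2 →₀ ℕ} (hx : x ∈ (f j).support) (hxT : x ≠ T j) (hy : y ∈ (f i).support)
    (h : ∑ k, Function.update T j x k = ∑ k, Function.update T i y k) : j = i ∧ x = y := by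
  have hmem : ∀ (k : Fin m) (z : Fin 2 →₀ ℕ), z ∈ (f k).support → ∀ k', Function.update T k z k' ∈ (f k').support := by
    intro k z hz k'
    rcases eq_or_ne k' k with rfl | hne
    · rw [Function.update_self]; exact hz
    · rw [Function.update_of_ne hne]; exact hT k'
  have hw := hinjf _ _ (hmem j x hx) (hmem i y hy) h
  have hji : j = i := by
    by_contra hne
    have h' := congrFun hw j
    rw [Function.update_self, Function.update_of_ne hne] at h'
    exact hxT h'
  subst hji
  have h' := congrFun hw j
  rw [Function.update_self, Function.update_self] at h'
  exact ⟨rfl, h'⟩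

/-- Letters of a one-letter demotion lie in the frame. -/
theorem update_mem' (f : Fin m → MvPolynomial (Fin 2) ℂ) (T : Fin m → (Fin 2 →₀ ℕ)) (hT : ∀ j, T j ∈ (f j).support)
    {j : Fin m} {x : Fin 2 →₀ ℕ} (hx : x ∈ (f j).support) (i : Fin m) : Function.update T j x i ∈ (f i).support := by
  rcases eq_or_ne i j with rfl | hne
  · rw [Function.update_self]; exact hx
  · rw [Function.update_of_ne hne]; exact hT i

/-- **Word coefficient via letter ratios** (only `c(T_j) ≠ 0` is used):
`Π_j c(a_j) = (Π_j c(T_j)) · Π_{j demoted} c(a_j)/c(T_j)`. [folklore] -/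
theorem prod_coeff_ratio (f : Fin m → MvPolynomial (Fin 2) ℂ) (T : Fin m → (Fin 2 →₀ ℕ)) (hT : ∀ j, T j ∈ (f j).support)
    (a : Fin m → (Fin 2 →₀ ℕ)) :
    ∏ j, coeff (a j) (f j) = (∏ j, coeff (T j) (f j)) *
      ∏ j ∈ Finset.univ.filter (fun i => a i ≠ T i), (coeff (a j) (f j) / coeff (T j) (f j)) := by
  have h : ∀ j, coeff (a j) (f j) = coeff (T j) (f j) *
      (if j ∈ Finset.univ.filter (fun i => a i ≠ T i) then coeff (a j) (f j) / coeff (T j) (f j) else 1) := by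
    intro j
    by_cases hj : j ∈ Finset.univ.filter (fun i => a i ≠ T i)
    · rw [if_pos hj, mul_div_cancel₀ _ (mem_support_iff.1 (hT j))]
    · rw [if_neg hj, eq_T_of_not_mem_filter T hj, mul_one]
  rw [Finset.prod_congr rfl (fun j _ => h j), Finset.prod_mul_distrib, ← Finset.prod_filter,
    Finset.filter_mem_eq_inter, Finset.univ_inter]

/-- **Transfer through a letter matching.**  Given a word `a` of `f`, a set `D` of its demoted coordinates, and for each `j ∈ D`
a letter `y j` of `g` at coordinate `ι j` with the same gap, `ι` injective on `D`: some word of `g` demotes exactly `ι '' D`,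
has the top sum minus the gaps of `a` over `D`, and has coefficient `(Π c'(T')) · Π_{j∈D} c'(y j)/c'(T' (ι j))`. -/
theorem transfer_letters (g : Fin m → MvPolynomial (Fin 2) ℂ) (T T' : Fin m → (Fin 2 →₀ ℕ))
    (hT' : ∀ j, T' j ∈ (g j).support)
    (a : Fin m → (Fin 2 →₀ ℕ)) (D : Finset (Fin m)) (ι : Fin m → Fin m) (y : Fin m → (Fin 2 →₀ ℕ))
    (hy : ∀ j ∈ D, y j ∈ (g (ι j)).support ∧ y j ≠ T' (ι j) ∧ emb (T j) - emb (a j) = emb (T' (ι j)) - emb (y j))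
    (hinj : Set.InjOn ι D) :
    ∃ b : Fin m → (Fin 2 →₀ ℕ), (∀ i, b i ∈ (g i).support) ∧
      (Finset.univ.filter fun i => b i ≠ T' i) = D.image ι ∧
      emb (∑ i, b i) = emb (∑ i, T' i) - ∑ j ∈ D, (emb (T j) - emb (a j)) ∧
      ∏ i, coeff (b i) (g i) = (∏ i, coeff (T' i) (g i)) * ∏ j ∈ D, (coeff (y j) (g (ι j)) / coeff (T' (ι j)) (g (ι j))) := by
  rcases isEmpty_or_nonempty (Fin m) with hE | hE
  · have hD : D = ∅ := Finset.eq_empty_of_isEmpty D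
    subst hD
    refine ⟨T', hT', ?_, ?_, ?_⟩
    · ext i; exact (IsEmpty.false i).elim
    · rw [Finset.sum_empty, sub_zero]
    · rw [Finset.prod_empty, mul_one]
  set κ : Fin m → Fin m := Function.invFunOn ι (D : Set (Fin m)) with hκ
  have hκι : ∀ j ∈ D, κ (ι j) = j := fun j hj => hinj.leftInvOn_invFunOn hj
  have key : ∀ b : Fin m → (Fin 2 →₀ ℕ), (∀ i, b i = if i ∈ D.image ι then y (κ i) else T' i) →
      (∀ i, b i ∈ (g i).support) ∧ (Finset.univ.filter fun i => b i ≠ T' i) = D.image ι ∧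
      emb (∑ i, b i) = emb (∑ i, T' i) - ∑ j ∈ D, (emb (T j) - emb (a j)) ∧
      ∏ i, coeff (b i) (g i) = (∏ i, coeff (T' i) (g i)) *
        ∏ j ∈ D, (coeff (y j) (g (ι j)) / coeff (T' (ι j)) (g (ι j))) := by
    intro b hb
    have hbι : ∀ j ∈ D, b (ι j) = y j := by
      intro j hj; rw [hb, if_pos (Finset.mem_image_of_mem ι hj), hκι j hj]
    have hbmem : ∀ i, b i ∈ (g i).support := by
      intro i; rw [hb]
      split_ifs with h
      · obtain ⟨j, hj, rfl⟩ := Finset.mem_image.1 h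
        rw [hκι j hj]; exact (hy j hj).1
      · exact hT' i
    have hdset : (Finset.univ.filter fun i => b i ≠ T' i) = D.image ι := by
      ext i
      rw [Finset.mem_filter]
      simp only [Finset.mem_univ, true_and]
      constructor
      · intro h; by_contra hni; rw [hb, if_neg hni] at h; exact h rfl
      · intro h
        obtain ⟨j, hj, rfl⟩ := Finset.mem_image.1 h
        rw [hbι j hj]; exact (hy j hj).2.1
    refine ⟨hbmem, hdset, ?_, ?_⟩
    · rw [emb_sum_eq T' b, sum_gap_eq_sum_filter T' b, hdset, Finset.sum_image hinj]
      congr 1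
      refine Finset.sum_congr rfl fun j hj => ?_
      rw [hbι j hj]; exact ((hy j hj).2.2).symm
    · rw [prod_coeff_ratio g T' hT' b, hdset, Finset.prod_image hinj]
      congr 1
      refine Finset.prod_congr rfl fun j hj => ?_
      rw [hbι j hj]
  exact ⟨_, key (fun i => if i ∈ D.image ι then y (κ i) else T' i) (fun i => rfl)⟩

end Words

/-! ## Rigidity for two dissociated frames with `≤ 3` letters and no parallelogram coincidences

Data: functional `l`, factor tuples `f, g` (one product each), key-top tuples `T, T'` of their supports, dissociation of both
support frames, the no-parallelogram hypotheses at the corners `T p` / `T' p` (`hparf`, `hparg`), an exponent `e` above which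
everything is cancelled (`hzero`), and the common top (`htop`, `hTe`, from `top_eq`).  The letter bound `≤ 3` is NOT needed for
rigidity and vertex form (it only enters the count through `stub_topTupleCount`). -/

section Rigidity

variable {m : ℕ}

/-- **No double match.**  Two one-letter demotions of `g` at distinct coordinates cannot be matched to two DIFFERENT letters of
ONE coordinate `p` of `f` while the corresponding two-letter demotion of `g` lies key-above `e`: it would be cancelled, hence a word
of `f`, producing a parallelogram coincidence at `p`. -/
theorem no_double_match (l : (Fin 2 → ℝ) →L[ℝ] ℝ) (f g : Fin m → MvPolynomial (Fin 2) ℂ) (T T' : Fin m → (Fin 2 →₀ ℕ))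
    (hT' : ∀ j, T' j ∈ (g j).support)
    (hinjf : ∀ a b : Fin m → (Fin 2 →₀ ℕ), (∀ j, a j ∈ (f j).support) → (∀ j, b j ∈ (f j).support) →
      ∑ j, a j = ∑ j, b j → a = b)
    (hinjg : ∀ a b : Fin m → (Fin 2 →₀ ℕ), (∀ j, a j ∈ (g j).support) → (∀ j, b j ∈ (g j).support) →
      ∑ j, a j = ∑ j, b j → a = b)
    (hparf : ∀ (a : Fin m → (Fin 2 →₀ ℕ)) (p : Fin m) (x y : Fin 2 →₀ ℕ), (∀ j, a j ∈ (f j).support) →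
      x ∈ (f p).support → y ∈ (f p).support → x ≠ y → x ≠ T p → y ≠ T p →
      (∑ j, a j) + T p + T p ≠ (∑ j, T j) + x + y)
    (e : Fin 2 →₀ ℕ)
    (hzero : ∀ x : Fin 2 →₀ ℕ, x ≠ e → l (emb e) ≤ l (emb x) → coeff x (∏ j, f j) + coeff x (∏ j, g j) = 0)
    (htop : ∑ j, T j = ∑ j, T' j)
    {i₁ i₂ p : Fin m} (hi : i₁ ≠ i₂) {y₁ y₂ x₁ x₂ : Fin 2 →₀ ℕ}
    (hy₁ : y₁ ∈ (g i₁).support) (hy₂ : y₂ ∈ (g i₂).support)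
    (hx₁ : x₁ ∈ (f p).support) (hx₂ : x₂ ∈ (f p).support) (hx : x₁ ≠ x₂) (hx₁T : x₁ ≠ T p) (hx₂T : x₂ ≠ T p)
    (hg₁ : emb (T' i₁) - emb y₁ = emb (T p) - emb x₁) (hg₂ : emb (T' i₂) - emb y₂ = emb (T p) - emb x₂)
    (hkey : lexKey l e < lexKey l (∑ i, Function.update (Function.update T' i₁ y₁) i₂ y₂ i)) : False := by
  set z : Fin m → (Fin 2 →₀ ℕ) := Function.update (Function.update T' i₁ y₁) i₂ y₂ with hz
  have hzmem : ∀ i, z i ∈ (g i).support := by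
    intro i
    rcases eq_or_ne i i₂ with rfl | h2
    · rw [hz, Function.update_self]; exact hy₂
    · rw [hz, Function.update_of_ne h2]
      rcases eq_or_ne i i₁ with rfl | h1
      · rw [Function.update_self]; exact hy₁
      · rw [Function.update_of_ne h1]; exact hT' i
  have hne : (∑ i, z i) ≠ e := fun h => by rw [h] at hkey; exact lt_irrefl _ hkey
  have hcz := hzero _ hne (apply_le_of_lexKey_le l hkey.le)
  have hcg : coeff (∑ i, z i) (∏ j, g j) ≠ 0 := by
    rw [coeff_word g hinjg _ hzmem]; exact prod_coeff_ne_zero g _ hzmem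
  have hfz : (∑ i, z i) ∈ (∏ j, f j).support := by
    rw [mem_support_iff]; intro h; rw [h, zero_add] at hcz; exact hcg hcz
  obtain ⟨a, ha, hsum⟩ := exists_word f hinjf hfz
  -- the parallelogram coincidence `Σ a + T p + T p = Σ T + x₁ + x₂`
  have hι : emb (∑ j, a j) + emb (T p) + emb (T p) = emb (∑ j, T j) + emb x₁ + emb x₂ := by
    rw [hsum, hz, emb_sum_update_update T' hi, ← htop, hg₁, hg₂]; abel
  apply hparf a p x₁ x₂ ha hx₁ hx₂ hx hx₁T hx₂T
  apply emb_injective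
  simpa only [emb_add] using hι

end Rigidity

end

end Summit.ValiantsHypothesis.ValiantsHypothesis.Theorems.NewtonFramesTwoProducts.FrameRungTwoTrinomial
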